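import Summits.QuantumFields.YangMills.Theorems.InfiniteVolumeContinuumOSExistenceOn
import Summits.QuantumFields.YangMills.Theorems.InfiniteVolumeContinuumOSExistenceHyper
import Summits.QuantumFields.YangMills.Theses.BalabanLadder
import HarnessLib

/-!
# Route `InfiniteVolumeContinuum` (target stmt-QuantumFields-19927): the target from the spine's legs with the
# rotation crux in its rev-2′ shape — the E1-upgrade corollary of the R85 memo, pre-certified

Seat `ym-infvol-p1` (R136 (i)).  HONEST FRAMING: a CONDITIONAL composition.  Its hypotheses are the spine route
`BalabanLadder`'s items `UV` (Track A's Prop, stmt-QuantumFields-19351), `UVSeamRec` (20043), `IR` (19354 — the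
volume-uniform lattice MASS GAP in units, open) BY NAME, and the route owner's rev-2′ TEXT of the rotation crux `ROT`
(R85 batch item 3, `p2-g21-files/R85_closes_preview_g21.lean` decl `ROT2'`, not yet the tree's `BalabanLadder.ROT`)
spelled INLINE; all four are OPEN.  The conclusion is the TEXT of the route's target `OSExistenceFromInfiniteVolume`
spelled inline (this module deliberately does not import the route file `Theses.InfiniteVolumeContinuum`, which stops
elaborating when `ROT` is restated — memo `R85-ROT-IMPACT-infvol.md`, evidence #2 on 19927).  Existence half only as a
CONCLUSION (OS0–OS3 + E0′ + NT∕NG, infinite-volume-first); but NOTE THE HYPOTHESES: with `IR` among them this is no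
longer «existence without the gap» — it is the E1 upgrade riding on the same four legs from which the spine derives
`YangMills` for the SU(2) class.  Not a gap proof, not Clay.

* `tendsto_exp_sizeLog_one_nhds_zero` — the two-loop unit of record `uRec β = exp (sizeLog β 1)` tends to `0`
  (the asymptotics block of `BalabanLadder.closes`, [folklore]).
* **`osExistenceIV_of_legs_rot2'`** — `UV → UVSeamRec → IR → ROT(rev 2′ text) → (text of OSExistenceFromInfiniteVolume)`:
  `UVSeamRec` gives `r` with floors and ceilings at `uRec`, `IR` the gap in units, rev-2′ `ROT` an unbounded half-side
  class with the Ward identities, and the class capstone `InfiniteVolume.osExistenceData_of_latticeRotWardOn` the data.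
  Under option (ii) of the owner's §5b this is the route's new deciding theorem up to the alias names; under option
  (iv) it is the conditional E1 corollary that accompanies the gap-free hyperoctahedral leaf.

References: A. Jaffe, E. Witten, Quantum Yang–Mills theory (2006) §5; C. King, CMP 103 (1986); K. Osterwalder,
R. Schrader, CMP 42 (1975).
-/

set_option autoImplicit false

noncomputable section

open MeasureTheory Filter Topology
open scoped BigOperators SchwartzMap
open Literature.MathematicalPhysics.QuantumFieldTheory hiding ZdEdge
open Literature.MathematicalPhysics.QuantumLattice
open Literature.MathematicalPhysics.AQFT
open Summit.QuantumFields.YangMills.Cruxes.OSLegsFromFemtoAndGap.DlrCollarTransfer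
open Summit.QuantumFields.YangMills.Theorems.InfiniteVolume

namespace Summit.QuantumFields.YangMills.Theorems.InfiniteVolumeContinuum

/-- The two-loop unit of record `exp (sizeLog β 1) = e^{−β/(4b₀)}·(β/(2b₀))^{b₁/(2b₀²)}` tends to `0` as `β → ∞` (the
linear term beats the logarithm; verbatim the asymptotics of `BalabanLadder.closes`). [folklore] -/
theorem tendsto_exp_sizeLog_one_nhds_zero :
    Tendsto (fun β : ℝ => Real.exp (Summit.QuantumFields.YangMills.Theorems.FemtoTransferGap.sizeLog β 1))
      atTop (𝓝 0) := by
  have hb0 : (0 : ℝ) < Summit.QuantumFields.YangMills.Theorems.FemtoTransferGap.b0 := by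
    unfold Summit.QuantumFields.YangMills.Theorems.FemtoTransferGap.b0; positivity
  have hsl : Tendsto (fun β : ℝ => Summit.QuantumFields.YangMills.Theorems.FemtoTransferGap.sizeLog β 1)
      atTop atBot := by
    set B0 : ℝ := Summit.QuantumFields.YangMills.Theorems.FemtoTransferGap.b0 with hB0
    set K : ℝ := Summit.QuantumFields.YangMills.Theorems.FemtoTransferGap.b1 / (2 * B0 ^ 2) with hK
    have h4 : (0 : ℝ) < 4 * B0 := by positivity
    have hf : Tendsto (fun β : ℝ => -(β / (4 * B0))) atTop atBot :=
      tendsto_neg_atTop_atBot.comp (tendsto_id.atTop_div_const h4)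
    have hg : (fun β : ℝ => K * Real.log β - K * Real.log (2 * B0)) =o[atTop] (fun β : ℝ => -(β / (4 * B0))) := by
      have h1 : (fun β : ℝ => K * Real.log β - K * Real.log (2 * B0)) =o[atTop] (fun β : ℝ => β) := by
        have hlog : (fun β : ℝ => K * Real.log β) =o[atTop] (fun β : ℝ => β) :=
          Real.isLittleO_log_id_atTop.const_mul_left K
        have hc : (fun _ : ℝ => K * Real.log (2 * B0)) =o[atTop] (fun β : ℝ => β) :=
          Asymptotics.isLittleO_const_left.2
            (Or.inr (show Tendsto (fun β : ℝ => ‖β‖) atTop atTop from tendsto_norm_atTop_atTop))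
        exact hlog.sub hc
      have h2 : (fun β : ℝ => β) =O[atTop] (fun β : ℝ => -(β / (4 * B0))) := by
        refine Asymptotics.IsBigO.of_bound (4 * B0) (Eventually.of_forall fun β => ?_)
        rw [norm_neg, norm_div, Real.norm_of_nonneg h4.le, mul_div_cancel₀ _ h4.ne']
      exact h1.trans_isBigO h2
    have hsum : Tendsto ((fun β : ℝ => -(β / (4 * B0))) + fun β : ℝ => K * Real.log β - K * Real.log (2 * B0))
        atTop atBot :=
      ((Asymptotics.IsEquivalent.refl.add_isLittleO hg).symm).tendsto_atBot hf
    refine hsum.congr' ?_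
    filter_upwards [eventually_gt_atTop (0 : ℝ)] with β hβ
    simp only [Pi.add_apply, Summit.QuantumFields.YangMills.Theorems.FemtoTransferGap.sizeLog, hK, hB0, Nat.cast_one,
      Real.log_one]
    rw [Real.log_div (mul_pos two_pos hb0).ne' hβ.ne']
    ring
  exact Real.tendsto_exp_atBot.comp hsl

/-- **The target's text from the four legs with `ROT` in rev-2′ shape.**  IF Track A's `UV`, the seam `UVSeamRec`,
the infrared leg `IR` and the rev-2′ rotation leg hold, THEN for every compact simple `G ≃ₜ* SU(2)` there are `r`, the
unit of record, couplings, odd-torus limit states, a one-field family and plane-string limits with the DATA clause and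
OS0–OS3 + E0′ + NT∕NG — the text of `Theses.InfiniteVolumeContinuum.OSExistenceFromInfiniteVolume`.  Pure composition
over `osExistenceData_of_latticeRotWardOn`; every hypothesis is an OPEN item. [folklore] -/
theorem osExistenceIV_of_legs_rot2' (hUV : Summit.QuantumFields.YangMills.Theses.BalabanLadder.UV)
    (hSeam : Summit.QuantumFields.YangMills.Theses.BalabanLadder.UVSeamRec)
    (hIR : Summit.QuantumFields.YangMills.Theses.BalabanLadder.IR)
    (hROT2 : ∀ (G : Type) [Group G] [TopologicalSpace G] [IsTopologicalGroup G] [CompactSpace G],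
      IsCompactSimpleLieGroup G → letI : MeasurableSpace G := borel G; haveI : BorelSpace G := ⟨rfl⟩;
      ∀ (r : LatticeRep G) (a : ℝ → ℝ), (∀ β, 0 < a β) → Tendsto a atTop (𝓝 0) →
        LowerBounds G r a → MomentBounds6 G r a → GapInUnits G r a →
          ∃ S : Set ℕ, Summit.QuantumFields.YangMills.Theorems.ROT.UnboundedClass S ∧
            Summit.QuantumFields.YangMills.Theorems.ROT.LatticeRotWardOn G r a S) :
    ∀ (G : Type) [Group G] [TopologicalSpace G] [IsTopologicalGroup G] [CompactSpace G], IsCompactSimpleLieGroup G → Nonempty (G ≃ₜ* Matrix.specialUnitaryGroup (Fin 2) ℂ) → letI : MeasurableSpace G := borel G; haveI : BorelSpace G := ⟨rfl⟩; ∃ (r : LatticeRep G) (a : ℝ → ℝ) (β : ℕ → ℝ) (μ : ℕ → Measure (LGConfig 4 G)) (S₁ : SchwingerFamily (EuclideanSpace ℝ (Fin 4))) (T : (n : ℕ) → (Fin n → Fin 4 × Fin 4) → (SchwartzMap (Fin n → EuclideanSpace ℝ (Fin 4)) ℂ →L[ℂ] ℂ)), (∀ β, 0 < a β) ∧ Filter.Tendsto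 a Filter.atTop (nhds 0) ∧ (Filter.Tendsto β Filter.atTop Filter.atTop ∧ (∀ k, μ k ∈ oddTorusLimitPoints r (β k)) ∧ (∀ F : SchwartzMap (Fin 0 → EuclideanSpace ℝ (Fin 4)) ℂ, S₁ 0 F = F default) ∧ (∀ F : SchwartzMap (Fin 1 → EuclideanSpace ℝ (Fin 4)) ℂ, S₁ 1 F = 0) ∧ (∀ n : ℕ, 2 ≤ n → ∀ F : SchwartzMap (Fin n → EuclideanSpace ℝ (Fin 4)) ℂ, S₁ n F = ∑ q ∈ Fintype.piFinset (fun _ : Fin n => Finset.univ.filter fun p : Fin 4 × Fin 4 => p.1 < p.2), T n q F) ∧ (∀ n : ℕ, 2 ≤ n → ∀ q : Fin n → Fin 4 × Fin 4, (∀ i, (q i).1 < (q i).2) → ∀ F : SchwartzMap (Fin n → EuclideanSpace ℝ (Fin 4)) ℂ, IsOffDiagonal F → Filter.Tendsto (fun k => ∑' x : Fin n → (Fin 4 → ℤ), ((stateMomentStr G r (μ k) n q x : ℝ) : ℂ) * F (fun l => a (β k) • siteToE (x l) + (a (β k) / 2) • (EuclideanSpace.single (q l).1 (1 : ℝ) +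 EuclideanSpace.single (q l).2 (1 : ℝ)))) Filter.atTop (nhds (T n q F)))) ∧ S₁.toLabelled.IsNormalized ∧ S₁.toLabelled.IsHermitian ∧ S₁.toLabelled.HasLinearGrowth ∧ S₁.toLabelled.IsEuclideanInvariant ∧ S₁.toLabelled.IsReflectionPositive ∧ S₁.toLabelled.IsSymmetric ∧ (∀ (n : ℕ) (t : EuclideanSpace ℝ (Fin 4)) (F : SchwartzMap (Fin n → EuclideanSpace ℝ (Fin 4)) ℂ), IsOffDiagonal F → S₁ n (translateMulti t F) = S₁ n F) ∧ (∃ (F₁ G₁ : SchwartzMap (Fin 1 → EuclideanSpace ℝ (Fin 4)) ℂ) (H₁ : SchwartzMap (Fin (1 + 1) → EuclideanSpace ℝ (Fin 4)) ℂ), IsTimeOrdered F₁ ∧ IsTimeOrdered G₁ ∧ IsAppendTensorOf H₁ (osAdjoint F₁) G₁ ∧ S₁.toLabelled (1 + 1) (fun _ => ()) H₁ ≠ S₁.toLabelled 1 (fun _ => ()) (osAdjoint F₁) * S₁.toLabelled 1 (fun _ => ()) G₁) ∧ (∃ (f g h : SchwartzMap (EuclideanSpace ℝ (Fin 4)) ℂ)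 (Ffgh : SchwartzMap (Fin 3 → EuclideanSpace ℝ (Fin 4)) ℂ) (Fgh Ffh Ffg : SchwartzMap (Fin 2 → EuclideanSpace ℝ (Fin 4)) ℂ) (Ff Fg Fh : SchwartzMap (Fin 1 → EuclideanSpace ℝ (Fin 4)) ℂ), IsTensorOf Ffgh ![f, g, h] ∧ IsOffDiagonal Ffgh ∧ IsTensorOf Fgh ![g, h] ∧ IsTensorOf Ffh ![f, h] ∧ IsTensorOf Ffg ![f, g] ∧ IsTensorOf Ff ![f] ∧ IsTensorOf Fg ![g] ∧ IsTensorOf Fh ![h] ∧ S₁.toLabelled 3 (fun _ => ()) Ffgh - S₁.toLabelled 1 (fun _ => ()) Ff * S₁.toLabelled 2 (fun _ => ()) Fgh - S₁.toLabelled 1 (fun _ => ()) Fg * S₁.toLabelled 2 (fun _ => ()) Ffh - S₁.toLabelled 1 (fun _ => ()) Fh * S₁.toLabelled 2 (fun _ => ()) Ffg + 2 * (S₁.toLabelled 1 (fun _ => ()) Ff * S₁.toLabelled 1 (fun _ => ()) Fg * S₁.toLabelled 1 (fun _ => ()) Fh) ≠ 0) := by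
  intro G _ _ _ _ hG hcl
  letI : MeasurableSpace G := borel G
  haveI : BorelSpace G := ⟨rfl⟩
  have hu : ∀ β : ℝ, 0 < Real.exp (Summit.QuantumFields.YangMills.Theorems.FemtoTransferGap.sizeLog β 1) :=
    fun β => Real.exp_pos _
  have hu0 := tendsto_exp_sizeLog_one_nhds_zero
  obtain ⟨r, hlb, hmb⟩ := hSeam hUV G hG hcl
  have hgap := hIR G hG r _ hu hu0 hlb
  obtain ⟨S, hS, hW⟩ := hROT2 G hG r _ hu hu0 hlb hmb hgap
  obtain ⟨β, μ, S₁, T, h⟩ := osExistenceData_of_latticeRotWardOn r hu hu0 hlb hmb hS hW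
  exact ⟨r, _, β, μ, S₁, T, hu, hu0, h⟩

/-! ## Appended 2026-08-26 (g2): the GAP-FREE hyperoctahedral leaf from `UV ∧ UVSeamRec` (memo options (iii′)∕(iv))

The composition of the route-file-free data theorem `osExistenceHyperData_of_floors_ceilings`
(`Theorems/InfiniteVolumeContinuumOSExistenceHyper.lean`) with the spine's legs `UV`, `UVSeamRec` BY NAME: no `IR`, no `ROT`
among the hypotheses — and correspondingly hyperoctahedral (signed-permutation) invariance instead of full E1 in the
conclusion.  HONEST FRAMING as in the module docstring: conditional on two OPEN spine items; existence half only; not Clay. -/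

/-- **The hyperoctahedral leaf from `UV ∧ UVSeamRec` BY NAME** (SU(2) class, unit of record): IF Track A's apex
package (`BalabanLadder.UV`) and the seam (`BalabanLadder.UVSeamRec`) hold, THEN for every compact simple
`G ≃ₜ* SU(2)` the infinite-volume-first continuum data exist with OS0, E0′, hyperoctahedral invariance, E2, E3,
translations, NT and NG.  Pure composition; both hypotheses are OPEN items; NO rotation and NO infrared hypothesis —
and correspondingly no full E1 in the conclusion. [folklore] -/
theorem osExistenceIVHyper_of_legs (hUV : Summit.QuantumFields.YangMills.Theses.BalabanLadder.UV)
    (hSeam : Summit.QuantumFields.YangMills.Theses.BalabanLadder.UVSeamRec) :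
    ∀ (G : Type) [Group G] [TopologicalSpace G] [IsTopologicalGroup G] [CompactSpace G], IsCompactSimpleLieGroup G → Nonempty (G ≃ₜ* Matrix.specialUnitaryGroup (Fin 2) ℂ) → letI : MeasurableSpace G := borel G; haveI : BorelSpace G := ⟨rfl⟩; ∃ (r : LatticeRep G) (a : ℝ → ℝ) (β : ℕ → ℝ) (μ : ℕ → Measure (LGConfig 4 G)) (S₁ : SchwingerFamily (EuclideanSpace ℝ (Fin 4))) (T : (n : ℕ) → (Fin n → Fin 4 × Fin 4) → (SchwartzMap (Fin n → EuclideanSpace ℝ (Fin 4)) ℂ →L[ℂ] ℂ)), (∀ β, 0 < a β) ∧ Filter.Tendsto a Filter.atTop (nhds 0) ∧ (Filter.Tendsto β Filter.atTop Filter.atTop ∧ (∀ k, μ k ∈ oddTorusLimitPoints r (β k)) ∧ (∀ F : SchwartzMap (Fin 0 → EuclideanSpace ℝ (Fin 4)) ℂ, S₁ 0 F = F default) ∧ (∀ F : SchwartzMap (Fin 1 → EuclideanSpace ℝ (Fin 4)) ℂ, S₁ 1 F = 0) ∧ (∀ n : ℕ, 2 ≤ n → ∀ F : SchwartzMap (Fin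 n → EuclideanSpace ℝ (Fin 4)) ℂ, S₁ n F = ∑ q ∈ Fintype.piFinset (fun _ : Fin n => Finset.univ.filter fun p : Fin 4 × Fin 4 => p.1 < p.2), T n q F) ∧ (∀ n : ℕ, 2 ≤ n → ∀ q : Fin n → Fin 4 × Fin 4, (∀ i, (q i).1 < (q i).2) → ∀ F : SchwartzMap (Fin n → EuclideanSpace ℝ (Fin 4)) ℂ, IsOffDiagonal F → Filter.Tendsto (fun k => ∑' x : Fin n → (Fin 4 → ℤ), ((stateMomentStr G r (μ k) n q x : ℝ) : ℂ) * F (fun l => a (β k) • siteToE (x l) + (a (β k) / 2) • (EuclideanSpace.single (q l).1 (1 : ℝ) + EuclideanSpace.single (q l).2 (1 : ℝ)))) Filter.atTop (nhds (T n q F)))) ∧ S₁.toLabelled.IsNormalized ∧ S₁.toLabelled.IsHermitian ∧ S₁.toLabelled.HasLinearGrowth ∧ (∀ (n : ℕ) (R : EuclideanSpace ℝ (Fin 4) ≃ₗᵢ[ℝ] EuclideanSpace ℝ (Fin 4)), (∀ i : Fin 4, ∃ j : Fin 4, R (EuclideanSpace.single i 1) = EuclideanSpace.single j 1 ∨ R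 (EuclideanSpace.single i 1) = -EuclideanSpace.single j 1) → ∀ F : SchwartzMap (Fin n → EuclideanSpace ℝ (Fin 4)) ℂ, IsOffDiagonal F → S₁ n (linActMulti R F) = S₁ n F) ∧ S₁.toLabelled.IsReflectionPositive ∧ S₁.toLabelled.IsSymmetric ∧ (∀ (n : ℕ) (t : EuclideanSpace ℝ (Fin 4)) (F : SchwartzMap (Fin n → EuclideanSpace ℝ (Fin 4)) ℂ), IsOffDiagonal F → S₁ n (translateMulti t F) = S₁ n F) ∧ (∃ (F₁ G₁ : SchwartzMap (Fin 1 → EuclideanSpace ℝ (Fin 4)) ℂ) (H₁ : SchwartzMap (Fin (1 + 1) → EuclideanSpace ℝ (Fin 4)) ℂ), IsTimeOrdered F₁ ∧ IsTimeOrdered G₁ ∧ IsAppendTensorOf H₁ (osAdjoint F₁) G₁ ∧ S₁.toLabelled (1 + 1) (fun _ => ()) H₁ ≠ S₁.toLabelled 1 (fun _ => ()) (osAdjoint F₁) * S₁.toLabelled 1 (fun _ => ()) G₁) ∧ (∃ (f g h : SchwartzMap (EuclideanSpace ℝ (Fin 4)) ℂ) (Ffgh : SchwartzMap (Fin 3 →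 EuclideanSpace ℝ (Fin 4)) ℂ) (Fgh Ffh Ffg : SchwartzMap (Fin 2 → EuclideanSpace ℝ (Fin 4)) ℂ) (Ff Fg Fh : SchwartzMap (Fin 1 → EuclideanSpace ℝ (Fin 4)) ℂ), IsTensorOf Ffgh ![f, g, h] ∧ IsOffDiagonal Ffgh ∧ IsTensorOf Fgh ![g, h] ∧ IsTensorOf Ffh ![f, h] ∧ IsTensorOf Ffg ![f, g] ∧ IsTensorOf Ff ![f] ∧ IsTensorOf Fg ![g] ∧ IsTensorOf Fh ![h] ∧ S₁.toLabelled 3 (fun _ => ()) Ffgh - S₁.toLabelled 1 (fun _ => ()) Ff * S₁.toLabelled 2 (fun _ => ()) Fgh - S₁.toLabelled 1 (fun _ => ()) Fg * S₁.toLabelled 2 (fun _ => ()) Ffh - S₁.toLabelled 1 (fun _ => ()) Fh * S₁.toLabelled 2 (fun _ => ()) Ffg + 2 * (S₁.toLabelled 1 (fun _ => ()) Ff * S₁.toLabelled 1 (fun _ => ()) Fg * S₁.toLabelled 1 (fun _ => ()) Fh) ≠ 0) := by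
  intro G _ _ _ _ hG hcl
  letI : MeasurableSpace G := borel G
  haveI : BorelSpace G := ⟨rfl⟩
  have hu : ∀ β : ℝ, 0 < Real.exp (Summit.QuantumFields.YangMills.Theorems.FemtoTransferGap.sizeLog β 1) :=
    fun β => Real.exp_pos _
  have hu0 := tendsto_exp_sizeLog_one_nhds_zero
  obtain ⟨r, hlb, hmb⟩ := hSeam hUV G hG hcl
  obtain ⟨β, μ, S₁, T, h⟩ := osExistenceHyperData_of_floors_ceilings r hu hu0 hlb hmb
  exact ⟨r, _, β, μ, S₁, T, hu, hu0, h⟩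

end Summit.QuantumFields.YangMills.Theorems.InfiniteVolumeContinuum

end
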